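import Summits.BirchSwinnertonDyer.Rank1Residual.Supersingular.X7VisibilityL1CertLocTorRecordsC6
import Summits.BirchSwinnertonDyer.Rank1Residual.Supersingular.X7SevenCongruenceCertificates
import HarnessLib

/-!
# N5 VISIBILITY at `p = 7`: the `7`-CONGRUENCE binder `θ`/`hθ` DISCHARGED by a kernel certificate on Fisher's `X_E(7)` — PART B
# (the eighth final-layer `p = 7` twin: `422370du1` three-kind form, on the base `X7VisibilityL1CertLocTorRecordsC6`; x10b gen 26 split of gen 25's
# verified 8-theorem consumer — parts A = `X7VisibilitySevenCongCertRecords.lean` (7 twins, p392235 ACCEPTED) and B = this file)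

Cell `b2b-bsdres`, supersingular family, prover A = unit `b2b-bsdres-x10b` (gen 25).  THEOREMS ONLY (1; part B of the gen-26 split — the other seven are `X7VisibilitySevenCongCertRecords.lean`).  Each theorem is EXACTLY
a final-layer visibility offer (`X7VisibilityL1CertLocTorRecordsC3/C4/C6.lean`, `X7Visibility5L1CertLocTorRecords02/05/06/07.lean`:
Cremona binders → `hball0`, every local torsion binder proved in the kernel) with its LAST DATUM BINDER — the `7`-congruence
`θ : F[7] ≃+ W[7]`, `hθ` (Galois-equivariant) of the rank-2 partner `F`, i.e. the congruence itself, so far evidenced only by trace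
comparison outside the kernel — SUPPLIED by the kernel certificate `sevenCongruent_x7_<label>_7` of `X7SevenCongruenceCertificates.lean`:
a rational point `P` of the twisted Klein quartic `X_W(7)` (Fisher, LMS JCM 17 (2014), Thm. 3.9) at which the member of Fisher's family
(4.8) (Thm. 4.6/4.8) is `ℚ`-isomorphic to `F`, checked by `decide +kernel`.  The price is ONE more named PUBLISHED fact among the
hypotheses: `hF7 : thm48_sevenCongruent_twistQuartic7` (Fisher 2014 Thm. 4.8 with Thm. 4.6 / 3.9,
`Literature/NumberTheory/EllipticCurves/Fisher2014/KleinQuarticTwistSevenCongruence.lean`).  BINDERS LEFT after this file: the named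
facts `hCT hW hGZK hmod hϖ hU hU2 hF7` [+ `hF44 hMR` on the five-kind forms]; the two models; `f`/`hf`/`hball0` — the same list as the
`p = 5` offers whose congruence comes from Fisher's Hesse families (`hF13`/`hF44`/`hF58`).  NO table entry, NO local datum, NO rank
datum, NO congruence datum.  Per pair (OFFERS for referee A); NOT class theorems; nothing booked; X7 stays CONSTRUCTION-SHAPED.

HONEST FRAMING (run/shared/lean/b2b/bsd-rank1-residual/, verbatim in every file): the goal of the
cell is to DELETE the COMBINATION-SHAPED residual classes of the Birch–Swinnerton-Dyer formula for
ALL analytic-rank `≤ 1` elliptic curves over `ℚ` — "full BSD formula for every rank `≤ 1` curve in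
class `C`" assembled STRICTLY from published theorems — so that the rank-`≤ 1` remainder becomes
exactly the CONSTRUCTION-SHAPED classes, which are TYPED (missing-input `Prop`s), NOT attempted.
This is not "finishing BSD".

References: [Fisher2014SevenElevenCongruent] Thm. 3.9, 4.6, 4.8; [Wuthrich2014] Prop. 21; [CremonaMazur2000] §3; [Fisher2016Visualizing7]
Thm. 4.4; [MazurRubin2015]; [SilvermanAEC2009] VII.3.1, X.4.14; [Cremona2006] Table 1; HOME/b2b-bsdres-x10b/X7-KURIHARA.md §28.
-/

set_option autoImplicit false

noncomputable section

open scoped Classical MatrixGroups ModularForm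

open CongruenceSubgroup WeierstrassCurve Literature.NumberTheory.EllipticCurves
  Literature.NumberTheory.EllipticCurves.Rank1Residual
  Literature.NumberTheory.EllipticCurves.Rank1Residual.Typed
  Literature.NumberTheory.EllipticCurves.Rank1Residual.X11RankOneCertificates
  Literature.NumberTheory.EllipticCurves.Wuthrich2014
  Literature.NumberTheory.EllipticCurves.Fisher2016
  Literature.NumberTheory.EllipticCurves.Fisher2012
  Summit.BirchSwinnertonDyer.BirchSwinnertonDyer.Rank1Residual.IntModel
  Summit.BirchSwinnertonDyer.Rank1Residual.X11b
  Literature.NumberTheory.EllipticCurves.ModularForms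
  Summit.BirchSwinnertonDyer.BirchSwinnertonDyer.Rank2Observatory.Tam
open NumberField IsDedekindDomain Rat.HeightOneSpectrum
open Summit.BirchSwinnertonDyer.Rank1Residual.Supersingular.LocalOddTorsion

namespace Summit.BirchSwinnertonDyer.Rank1Residual.Supersingular

open Literature.NumberTheory.EllipticCurves.Fisher2014

/-- **`BSD(E,7)` for `422370du1` (three-kind, kind (iii) at 13 form), OFFERED — the `7`-CONGRUENCE of the rank-2 partner `422370dy1` PROVED in the kernel modulo Fisher's Thm. 4.8.**
Exactly the final-layer twin `bsdp_x7r0visblt_422370du1_7_of_congr` (`X7VisibilityL1CertLocTorRecordsC6.lean`) with `θ`/`hθ` SUPPLIED by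
`sevenCongruent_x7_422370du1_7 hF7 hWeq hFeq` — the rational point `P = (−37749902011563 : 5677789 : 2)` of `X_W(7)` (Fisher's Thm. 3.9 quartic for `W`'s `c₄,c₆`-model)
at which the member of the family (4.8) is `ℚ`-isomorphic to `F` (exact certificate, `decide +kernel`; point by resultant, kit j229162).
BINDERS LEFT: the named facts displayed above (`… hF7`); the models `hWeq`/`hFeq`; `f`, `hf`, `hball0` — NO table entry, NO local datum, NO rank
datum, NO congruence datum.  Per pair (an OFFER for referee A); NOT a class theorem; nothing booked.
[cite: Fisher2014SevenElevenCongruent, Thm. 4.8 with Thm. 4.6 and Thm. 3.9] [cite: Wuthrich2014, Prop. 21 (p. 400)] [cite: CremonaMazur2000, §3 and Table 1]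
[cite: Cremona2006, Table 1 (Cremona labels 422370du1, 422370dy1)] -/
theorem bsdp_x7r0visbltk_422370du1_7
    (hCT : exists_casselsTate_pairing (K := ℚ)) (hW : sha_dvd_analyticSha)
    (hGZK : rank_eq_analyticRank_of_analyticRank_le_one) (hmod : hasEntireLFunction_rat)
    (hϖ : realPeriodRat_eq_unit_mul_plusPeriod)
    (hU : Silverman1994_thmV53_tateUniformisation.{0})
    (hU2 : Silverman1994_thmV53_corV54_tateUniformisation.{0})
    (hF7 : thm48_sevenCongruent_twistQuartic7)
    {W F : WeierstrassCurve ℚ} [W.IsElliptic] [W.IsGloballyMinimal] [F.IsElliptic] [F.IsGloballyMinimal]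
    (hWeq : W = ⟨1, -1, 1, -1782219521048, -925402892231841253⟩) (hFeq : F = ⟨1, -1, 1, -68, 2207⟩)
    -- the engine's LEVEL-ONE ENCLOSURE of T₀ = L(E,1)/ω₁ (job j202394; replaces the Cremona data r_an = 0, #Ш_an of the source)
    {N : ℕ} [NeZero N] (f : CuspForm (Gamma0 N) 2) (hf : IsNewformOf W f)
    (hball0 : ∃ mid rad : ℝ, rad ≤ 1 / 10 ^ (20 : ℕ) ∧ |mid - ((1960 : ℤ) : ℝ)| ≤ 1 / 10 ^ (20 : ℕ) ∧
      |((1 : ℕ) : ℝ) * (((1 : ℕ) : ℝ) * ((W.entireLFunction 1).re / plusPeriod f)) - mid| ≤ rad) :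
        BSDp W 7 := by
  obtain ⟨θ, hθ⟩ := sevenCongruent_x7_422370du1_7 hF7 hWeq hFeq
  exact bsdp_x7r0visblt_422370du1_7_of_congr hCT hW hGZK hmod hϖ hU hU2 hWeq hFeq f hf hball0 θ hθ

end Summit.BirchSwinnertonDyer.Rank1Residual.Supersingular

end
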